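import Summits.QuantumFields.BalabanUV.Beta.D1BFx.ShellWindowEnd
import Summits.QuantumFields.BalabanUV.Beta.D1BFx.ShellFullSum
import Summits.QuantumFields.BalabanUV.Beta.D1BFx.ShellStencils

/-!
# `BalabanUV.Beta.D1BFx.ShellGradedRoad` — road «BF-x» for binder row D1, sub-leaf C3-SHELL (the scalar END):
# THE SCALAR WALL WITH THE MIXED-SECOND-DIFFERENCE ROWS h2/d2 IN SHELL-ℓ¹ CURRENCY

HONEST DEPENDENCY (page 1, mandatory): continuum YM on T⁴ ⇐ BetaPertH ∧ nine spine estimates (0/9 proved); BetaPertH ⇐ (D1) ∧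
(D4) ∧ CAP+tail; G-an2-4 gates asym, D1 and NE2/3/4.  HONEST FRAMING (cell contract, verbatim): «discharging `BetaPertH` makes
Bałaban's UV stability UNCONDITIONAL — a real constructive-QFT result; it is NOT the continuum limit and NOT the Clay problem.»
THIS MODULE DISCHARGES NOTHING of the wall: [folklore] bookkeeping composed BY NAME from this unit's `ShellWindowEnd` /
`ShellWindowLegs` / `ShellFullSum` / `ShellStencils`, an3's `SquareTable` (realised table `bfCoeff/bfP/bfQ`, `hdeg_bf`, `hval_bf`, the stencils
`stP/stQ/stK`, `stP_free/stQ_free/stP_sub/stQ_sub`), `WindowInterface.windowBound_of_scaleBound`.  No `def`, no `Prop` mirror, no cited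
fact, 0 sorry.
Bookkeeping for ONE road (BF-x) to ONE conjunct (D1); 0 wall binders instantiated; NOT D1, NOT `BetaPertH`, NOT continuum, NOT Clay.

ABSOLUTE RULE (cell charter, verbatim): «No internally-minted statement may enter as a cited fact. Every hypothesis is either
kernel-proved in this package or a verbatim quotation of a PUBLISHED theorem with page reference. The manuscript(s) under audit are NOT
citable for their own disputed steps — they are the thing under adjudication; programme-internal (2001/route/tribunal) claims are never
citable.»  Accordingly nothing below asserts that Bałaban's legs satisfy any row: every row is a HYPOTHESIS on a free scalar family
`Gf n b : ℤ⁴ → ℝ`.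

WHY (journal CLAIM l.11259; gen-3 RESULT l.10890, EVIDENCE-GRADE).  an3's scalar wall `SquareTable.oneLoopDrift_of_scalarBounds_avg` and
the road END `RoadEnd.d1Drift_of_strongRoad` take SIX POINTWISE graded rows on the scalar leg: `h0/h1/h2` (`|E_n| ≤ D₀/n²`,
`|∇E_n| ≤ D₁/n³`, `|D_{μν}E_n| ≤ D₂/n⁴` on the whole lattice, `E_n = G_n − gFree`) and `d0/d1/d2` (`|G_n(v)|, |∇G_n(v)|, |D_{μν}G_n(v)| ≤
A_j e^{−(δ/n)‖v‖}‖v‖^{−2−j}`).  On gen-3's evidence the MIXED second difference of the actual legs carries an extra `log n` on the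
block-EDGE layer (relative measure `(ρ/n)²`), so `h2`/`d2` AS TYPED would be unfeedable while their SHELL SUMS are of the typed size.  Here the
same ENDs are proved with `h2`/`d2` replaced by the SHELL rows
  `h2s : Σ_{‖v‖∞=r+1} |D_{μν}E_n(v)| ≤ D₂/n` on the window shells `r + 1 ≤ M(n)`,
  `d2s : Σ_{‖v‖∞=r+1} |D_{μν}G_n(v)| ≤ A₂ e^{−(δ/n)(r+1)}/(r+1)` on the exterior shells `r ≥ M(n)`,
and `h0/h1/d0/d1` VERBATIM.  The pointwise rows imply the shell rows (`#shell ≤ 80(r+1)³`: `h2 ⟹ h2s` with `D₂ ↦ 80D₂`, `d2 ⟹ d2s` with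
`A₂ ↦ 80A₂`), so both ENDs are strictly MORE GENERAL than the tree's.  Mechanism: in an3's realised table the mixed difference is the FIRST
leg of `inl 0, inl 1` (partner: a VALUE leg) and the SECOND leg of the ghost index `inr true` (partner: the VALUE leg `G`); every other leg
is a value or a first difference.  With the designated set `{inr true}` of `ShellWindowEnd.oneLoopDrift_of_shellLegRowsPow_identity_avg`
each leg carries exactly one row: pointwise for values/gradients, shell for the mixed differences.
* (stencil bookkeeping for the designated set `{inr true}`: companion `D1BFx/ShellStencils`.)
* `oneLoopDrift_of_scalarShellBounds_avg` — the scalar wall: an3's `oneLoopDrift_of_scalarBounds_avg` with `h2 ↦ h2s`, `d2 ↦ d2s`.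
* COMPANION `D1BFx/ShellRoadEnd`: the C3 twin `d1Drift_of_strongRoad_shell` (`RoadEnd.d1Drift_of_strongRoad` with `h2 ↦ h2s`, `d2 ↦ d2s`).
NOT HERE: that `Ga`'s diagonal or `Ggh` satisfy `h2s`/`d2s` (analytic; gen 3 proved `h0/h1/d0/d1` for the ghost leg, `GhostLegFree.ghLeg_rows`).
Unit `b2b-balaban-beta-d1-formalise-leaf-07` (gen 4), D1 formalisation swarm; `LEAVES-BFx.md` sub-row C3-SHELL.
-/

namespace Summit.QuantumFields.BalabanUV.Beta.D1BFx.ShellGradedRoad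

open Finset Filter Topology
open scoped BigOperators
open Literature.Probability.LatticeModels (annulus)
open Literature.MathematicalPhysics.QuantumFieldTheory.Balaban1983to89
open Literature.MathematicalPhysics.QuantumFieldTheory.Balaban1983to89.FlowStep (HBeta)
open Literature.MathematicalPhysics.QuantumFieldTheory.Balaban1983to89.Beta
open Literature.MathematicalPhysics.QuantumFieldTheory.Balaban1983to89.Beta.DyadicShell (Pt toReal supNorm mem_annulus_iff
  ne_zero_of_mem_annulus supNorm_eq_of_mem_sphere supNorm_eq_zero_iff)
open Literature.MathematicalPhysics.QuantumFieldTheory.Balaban1983to89.Beta.BubbleTransfer (Leg bubbleConst unitVec)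
open Literature.MathematicalPhysics.QuantumFieldTheory.Balaban1983to89.Beta.TwoPowerLegs (supNorm_sub_le_supNorm_add supNorm_unitVec
  supNorm_unitVec_add)
open Literature.MathematicalPhysics.QuantumFieldTheory.Balaban1983to89.Beta.LargeLWindow.WindowDecomposition (constA)
open Literature.MathematicalPhysics.QuantumFieldTheory.Balaban1983to89.Beta.LeadingCoefficient (kappaBal transverseValue)
open Literature.MathematicalPhysics.QuantumFieldTheory.Balaban1983to89.Beta.Drift (OneLoopDrift)
open Literature.MathematicalPhysics.QuantumFieldTheory.Balaban1983to89.Beta.MarginalTelescoping (composedCoeff IdentityForm)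
open Literature.MathematicalPhysics.QuantumFieldTheory.Balaban1983to89.Beta.WindowIdentification (fullSum)
open Literature.MathematicalPhysics.QuantumFieldTheory.Balaban1983to89.Beta.WindowInterface (windowBound_of_scaleBound)
open Literature.MathematicalPhysics.QuantumFieldTheory.Balaban1983to89.Beta.GhostTable (gFree ghostP ghostQ)
open Literature.MathematicalPhysics.QuantumFieldTheory.Balaban1983to89.Beta.SquareTable (BfIdx bfCoeff bfP bfQ sqP sqQ hdeg_bf hval_bf
  stP stQ stK stP_free stQ_free stP_sub stQ_sub two_le_bfQ_a decay_le_pow pow_shift_le)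
open Summit.QuantumFields.BalabanUV.Beta.D1BFx.ShellStencils (stP_inr_true stQ_inr_true a_bfP_inr_true a_bfP_inr_true_sub a_bfQ_inr_true
  a_bfQ_inr_true_sub stP_low abs_stQ_low_le abs_stQ_low_le_of_decay shell_sum_le_of_pointwise window_shape_le tail_shape_le grad_shape_le)
open Summit.QuantumFields.BalabanUV.Beta.D1BFx.ShellWindowLegs (shellTail_of_legRows)
open Summit.QuantumFields.BalabanUV.Beta.D1BFx.ShellWindowEnd (oneLoopDrift_of_shellLegRowsPow_identity_avg)
open Summit.QuantumFields.BalabanUV.Beta.D1BFx.ShellFullSum (hident_of_fullSum_avg_shell)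

noncomputable section

/-! ## The scalar wall with `h2`/`d2` in shell-ℓ¹ currency -/

section ScalarWall

variable {μ ν : Fin 4} {κB : Type*}

/-- [folklore] **THE BASE-POINT-AVERAGED SCALAR WALL, SHELL CURRENCY FOR THE MIXED DIFFERENCES** — an3's
`SquareTable.oneLoopDrift_of_scalarBounds_avg` with the rows `h2`/`d2` replaced by their SHELL-ℓ¹ forms `h2s` (window shells
`r + 1 ≤ M(n)`: `Σ_{‖v‖∞=r+1}|D_{μν}E_n(v)| ≤ D₂/n`) and `d2s` (exterior shells `r ≥ M(n)`: `Σ_{‖v‖∞=r+1}|D_{μν}G_n(v)| ≤ A₂e^{−(δ/n)(r+1)}/(r+1)`),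
`h0/h1/d0/d1`, the window data, the convex weights, the full-sum identification `hU` and `IdentityForm` VERBATIM.  (The tree's pointwise
`h2`/`d2` imply `h2s`/`d2s` with `D₂ ↦ 80D₂`, `A₂ ↦ 80A₂`.)  Proof: `ShellWindowEnd.oneLoopDrift_of_shellLegRowsPow_identity_avg` on the
realised table with the designated set `{inr true}` (§1) + `ShellFullSum.hident_of_fullSum_avg_shell`. -/
theorem oneLoopDrift_of_scalarShellBounds_avg {β : HBeta} (S : B12Beta.OneLoopSplit β) (hμν : μ ≠ ν) {N : ℝ} (hN : N ≠ 0)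
    {Lc : ℕ} (hL : 2 ≤ Lc) {μC : ℕ → ℕ → ℝ} {Bset : ℕ → Finset κB} {wt : ℕ → κB → ℝ} {Gf : ℕ → κB → Pt → ℝ} {D A : ℕ → ℝ}
    (hD : ∀ j, 0 ≤ D j) (hA : ∀ j, 0 ≤ A j) {δ U cc : ℝ} {M : ℕ → ℕ} (hδ : 0 < δ)
    (hwt0 : ∀ n : ℕ, 2 ≤ n → ∀ b ∈ Bset n, 0 ≤ wt n b) (hwt1 : ∀ n : ℕ, 2 ≤ n → ∑ b ∈ Bset n, wt n b = 1)
    (hc : 1 ≤ cc) (hM : ∀ L : ℕ, 2 ≤ L → 1 ≤ M L ∧ (L : ℝ) ≤ cc * M L) (hML : ∀ L : ℕ, 2 ≤ L → M L ≤ L)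
    (h0 : ∀ n : ℕ, 2 ≤ n → ∀ b ∈ Bset n, ∀ v, |Gf n b v - gFree v| ≤ D 0 / (n : ℝ) ^ 2)
    (h1 : ∀ n : ℕ, 2 ≤ n → ∀ b ∈ Bset n, ∀ v (ρ : Fin 4),
      |(Gf n b (v + unitVec ρ) - gFree (v + unitVec ρ)) - (Gf n b v - gFree v)| ≤ D 1 / (n : ℝ) ^ 3)
    (h2s : ∀ n : ℕ, 2 ≤ n → ∀ b ∈ Bset n, ∀ r : ℕ, r + 1 ≤ M n →
      ∑ v ∈ annulus 4 r (r + 1), |(Gf n b (v + unitVec ν + unitVec μ) - gFree (v + unitVec ν + unitVec μ)) -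
          (Gf n b (v + unitVec ν) - gFree (v + unitVec ν)) - (Gf n b (v + unitVec μ) - gFree (v + unitVec μ)) +
          (Gf n b v - gFree v)| ≤ D 2 / (n : ℝ))
    (d0 : ∀ n : ℕ, 2 ≤ n → ∀ b ∈ Bset n, ∀ v : Pt, v ≠ 0 → |Gf n b v| ≤ A 0 * Real.exp (-(δ / n) * supNorm v) / (supNorm v : ℝ) ^ 2)
    (d1 : ∀ n : ℕ, 2 ≤ n → ∀ b ∈ Bset n, ∀ v : Pt, v ≠ 0 → ∀ ρ : Fin 4,
      |Gf n b (v + unitVec ρ) - Gf n b v| ≤ A 1 * Real.exp (-(δ / n) * supNorm v) / (supNorm v : ℝ) ^ 3)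
    (d2s : ∀ n : ℕ, 2 ≤ n → ∀ b ∈ Bset n, ∀ r : ℕ, M n ≤ r →
      ∑ v ∈ annulus 4 r (r + 1), |Gf n b (v + unitVec ν + unitVec μ) - Gf n b (v + unitVec ν) - Gf n b (v + unitVec μ) + Gf n b v| ≤
        A 2 * Real.exp (-(δ / n) * ((r : ℝ) + 1)) / ((r : ℝ) + 1))
    (hU : ∀ m : ℕ, 1 ≤ m → |composedCoeff μC m - ∑ b ∈ Bset (Lc ^ m), wt (Lc ^ m) b * fullSum (stK μ ν N (Gf (Lc ^ m) b))| ≤ U)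
    (hid : IdentityForm μC S.β0) :
    OneLoopDrift (B12Normalization.stepBal N Lc)
      (constA (|kappaBal N| * 24 + |kappaBal N| * 110592) (bubbleConst Finset.univ (bfCoeff N) (bfP hμν) (bfQ hμν))
          (80 * (∑ i ∈ (Finset.univ : Finset BfIdx), |bfCoeff N i| *
              (A ((bfP hμν i).a - 2) * (A ((bfQ hμν i).a - 2) * 2 ^ (bfQ hμν i).a))) * (1 + cc / δ) + (U + 1) +
            ∑ i ∈ (Finset.univ : Finset BfIdx), |bfCoeff N i| *
              (80 * (((bfP hμν i).A + (bfP hμν i).B) * (80 * D ((bfQ hμν i).a - 2)) +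
                  80 * D ((bfP hμν i).a - 2) * ((bfQ hμν i).A + (bfQ hμν i).B)) +
                80 * D ((bfP hμν i).a - 2) * (80 * D ((bfQ hμν i).a - 2))))
          cc (kappaBal N * transverseValue)) S.β0 := by
  classical
  -- constants
  have hR : ∀ i ∈ (Finset.univ : Finset BfIdx), 0 ≤ 80 * D ((bfP hμν i).a - 2) := fun i _ => by have := hD ((bfP hμν i).a - 2); positivity
  have hS : ∀ i ∈ (Finset.univ : Finset BfIdx), 0 ≤ 80 * D ((bfQ hμν i).a - 2) := fun i _ => by have := hD ((bfQ hμν i).a - 2); positivity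
  have hR' : ∀ i ∈ (Finset.univ : Finset BfIdx), 0 ≤ A ((bfP hμν i).a - 2) := fun i _ => hA _
  have hS' : ∀ i ∈ (Finset.univ : Finset BfIdx), 0 ≤ A ((bfQ hμν i).a - 2) * 2 ^ (bfQ hμν i).a :=
    fun i _ => mul_nonneg (hA _) (by positivity)
  have hpow : ∀ m : ℕ, 1 ≤ m → 2 ≤ Lc ^ m := fun m hm => hL.trans (Nat.le_self_pow (by omega) Lc)
  have hmem : ∀ i : BfIdx, i ∉ ({Sum.inr true} : Finset BfIdx) ↔ i ≠ Sum.inr true := fun i => by simp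
  -- the stencil legs minus the table legs are the stencils of `E = G − gFree`
  have eP : ∀ (n : ℕ) (b : κB) (i : BfIdx) (w : Pt),
      stP μ ν (Gf n b) i w - (bfP hμν i).f n 0 w = stP μ ν (Gf n b - gFree) i w := fun n b i w => by
    rw [← stP_free hμν i n 0 w, stP_sub]
  have eQ : ∀ (n : ℕ) (b : κB) (i : BfIdx) (w : Pt),
      stQ μ ν (Gf n b) i w - (bfQ hμν i).f n 0 w = stQ μ ν (Gf n b - gFree) i w := fun n b i w => by
    rw [← stQ_free hμν i n 0 w, stQ_sub]
  -- shell points: norm `r+1`, nonzero, and inside the window when `r+1 ≤ M n`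
  have hsup : ∀ {r : ℕ} {w : Pt}, w ∈ annulus 4 r (r + 1) → (supNorm w : ℝ) = (r : ℝ) + 1 := fun hw => by
    rw [supNorm_eq_of_mem_sphere hw]; push_cast; ring
  -- the four EXTERIOR rows (also consumed by the identification's tail)
  have tFpt : ∀ m : ℕ, 1 ≤ m → ∀ b ∈ Bset (Lc ^ m), ∀ r : ℕ, M (Lc ^ m) ≤ r → ∀ w ∈ annulus 4 r (r + 1),
      ∀ i ∈ (Finset.univ : Finset BfIdx), i ∈ ({Sum.inr true} : Finset BfIdx) →
      |stP μ ν (Gf (Lc ^ m) b) i w| ≤ A ((bfP hμν i).a - 2) / ((r : ℝ) + 1) ^ (bfP hμν i).a := by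
    -- the designated first leg is the value: pointwise tail from `d0` (exponential dropped)
    intro m hm b hb r _ w hw i _ hiF
    rw [Finset.mem_singleton] at hiF
    subst hiF
    have hn := hpow m hm
    have hw0 : w ≠ 0 := ne_zero_of_mem_annulus hw
    rw [stP_inr_true, a_bfP_inr_true_sub, a_bfP_inr_true]
    have h := d0 _ hn b hb w hw0
    rw [hsup hw] at h
    refine h.trans ?_
    have hx : (0 : ℝ) ≤ δ / ((Lc ^ m : ℕ) : ℝ) * ((r : ℝ) + 1) := by positivity
    have hexp : Real.exp (-(δ / ((Lc ^ m : ℕ) : ℝ)) * ((r : ℝ) + 1)) ≤ 1 := Real.exp_le_one_iff.mpr (by linarith)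
    exact div_le_div_of_nonneg_right (mul_le_of_le_one_right (hA 0) hexp) (by positivity)
  have tGtsh : ∀ m : ℕ, 1 ≤ m → ∀ b ∈ Bset (Lc ^ m), ∀ r : ℕ, M (Lc ^ m) ≤ r →
      ∀ i ∈ (Finset.univ : Finset BfIdx), i ∈ ({Sum.inr true} : Finset BfIdx) →
      ∑ w ∈ annulus 4 r (r + 1), |stQ μ ν (Gf (Lc ^ m) b) i w| ≤
        80 * (A ((bfQ hμν i).a - 2) * 2 ^ (bfQ hμν i).a) * ((r : ℝ) + 1) ^ 3 / ((r : ℝ) + 1) ^ (bfQ hμν i).a *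
          Real.exp (-(δ / ((Lc ^ m : ℕ) : ℝ)) * ((r : ℝ) + 1)) := by
    -- the designated second leg is the mixed difference: shell tail `d2s`
    intro m hm b hb r hr i _ hiF
    rw [Finset.mem_singleton] at hiF
    subst hiF
    have hn := hpow m hm
    have ht0 : (0 : ℝ) < (r : ℝ) + 1 := by positivity
    simp_rw [stQ_inr_true, a_bfQ_inr_true_sub, a_bfQ_inr_true]
    refine (d2s _ hn b hb r hr).trans (tail_shape_le ht0 (Real.exp_pos _).le ?_)
    have := hA 2
    nlinarith [show (1 : ℝ) ≤ 80 * 2 ^ 4 by norm_num]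
  have tGtpt : ∀ m : ℕ, 1 ≤ m → ∀ b ∈ Bset (Lc ^ m), ∀ r : ℕ, M (Lc ^ m) ≤ r → ∀ w ∈ annulus 4 r (r + 1),
      ∀ i ∈ (Finset.univ : Finset BfIdx), i ∉ ({Sum.inr true} : Finset BfIdx) →
      |stQ μ ν (Gf (Lc ^ m) b) i w| ≤ A ((bfQ hμν i).a - 2) * 2 ^ (bfQ hμν i).a / ((r : ℝ) + 1) ^ (bfQ hμν i).a := by
    -- off the ghost index the second leg is a value or a gradient: pointwise tail (`2^b`-shifted), no `d2`
    intro m hm b hb r hr w hw i _ hiF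
    rw [hmem] at hiF
    have hn := hpow m hm
    have hc0 : (0 : ℝ) ≤ δ / ((Lc ^ m : ℕ) : ℝ) := by positivity
    exact abs_stQ_low_le_of_decay hμν i hiF hA hc0 (d0 _ hn b hb) (d1 _ hn b hb) (((hM _ hn).1).trans hr) hw
  have tFtsh : ∀ m : ℕ, 1 ≤ m → ∀ b ∈ Bset (Lc ^ m), ∀ r : ℕ, M (Lc ^ m) ≤ r →
      ∀ i ∈ (Finset.univ : Finset BfIdx), i ∉ ({Sum.inr true} : Finset BfIdx) →
      ∑ w ∈ annulus 4 r (r + 1), |stP μ ν (Gf (Lc ^ m) b) i w| ≤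
        80 * A ((bfP hμν i).a - 2) * ((r : ℝ) + 1) ^ 3 / ((r : ℝ) + 1) ^ (bfP hμν i).a *
          Real.exp (-(δ / ((Lc ^ m : ℕ) : ℝ)) * ((r : ℝ) + 1)) := by
    -- off the ghost index the first leg is the mixed difference (`d2s`) or the `μ`-gradient at `w` (`d1`, summed)
    intro m hm b hb r hr i _ hiF
    rw [hmem] at hiF
    have hn := hpow m hm
    have ht0 : (0 : ℝ) < (r : ℝ) + 1 := by positivity
    rcases stP_low hμν i hiF (Gf (Lc ^ m) b) with ⟨e, ha2, ha⟩ | ⟨e, ha1, ha⟩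
    · simp_rw [e, ha2, ha]
      refine (d2s _ hn b hb r hr).trans (tail_shape_le ht0 (Real.exp_pos _).le ?_)
      linarith [hA 2]
    · simp_rw [e, ha1, ha]
      have hpt : ∀ w ∈ annulus 4 r (r + 1), |Gf (Lc ^ m) b (w + unitVec μ) - Gf (Lc ^ m) b w| ≤
          A 1 / ((r : ℝ) + 1) ^ 3 * Real.exp (-(δ / ((Lc ^ m : ℕ) : ℝ)) * ((r : ℝ) + 1)) := by
        intro w hw
        have h := d1 _ hn b hb w (ne_zero_of_mem_annulus hw) μ
        rw [hsup hw] at h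
        refine h.trans (le_of_eq ?_)
        ring
      exact (shell_sum_le_of_pointwise (by have := hA 1; positivity) hpt).trans (le_of_eq (by ring))
  -- the exterior shell sums of `stK` (for the identification's window truncation)
  have hE : 0 ≤ ∑ i ∈ (Finset.univ : Finset BfIdx), |bfCoeff N i| *
      (A ((bfP hμν i).a - 2) * (A ((bfQ hμν i).a - 2) * 2 ^ (bfQ hμν i).a)) :=
    Finset.sum_nonneg fun i hi => mul_nonneg (abs_nonneg _) (mul_nonneg (hR' i hi) (hS' i hi))
  have htail : ∀ m : ℕ, 1 ≤ m → ∀ b ∈ Bset (Lc ^ m), ∀ r : ℕ, M (Lc ^ m) ≤ r →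
      ∑ w ∈ annulus 4 r (r + 1), |stK μ ν N (Gf (Lc ^ m) b) w| ≤
        80 * (∑ i ∈ (Finset.univ : Finset BfIdx), |bfCoeff N i| *
          (A ((bfP hμν i).a - 2) * (A ((bfQ hμν i).a - 2) * 2 ^ (bfQ hμν i).a))) / ((r : ℝ) + 1) *
          Real.exp (-(δ / ((Lc ^ m : ℕ) : ℝ)) * ((r : ℝ) + 1)) := by
    intro m hm b hb r hr
    have h := shellTail_of_legRows (hdeg_bf hμν) μ ν ({Sum.inr true} : Finset BfIdx)
      (F := fun i w => stP μ ν (Gf (Lc ^ m) b) i w) (G := fun i w => stQ μ ν (Gf (Lc ^ m) b) i w) (cc₀ := bfCoeff N) hR' hS'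
      (fun i hi hiF w hw => tFpt m hm b hb r hr w hw i hi hiF) (fun i hi hiF => tGtsh m hm b hb r hr i hi hiF)
      (fun i hi hiF w hw => tGtpt m hm b hb r hr w hw i hi hiF) (fun i hi hiF => tFtsh m hm b hb r hr i hi hiF)
    simpa only [stK] using h
  refine oneLoopDrift_of_shellLegRowsPow_identity_avg S (hdeg_bf hμν) hμν hN (hval_bf hμν N) hL ({Sum.inr true} : Finset BfIdx)
    (F' := fun b i n w => stP μ ν (Gf n b) i w) (G' := fun b i n w => stQ μ ν (Gf n b) i w) hwt0 hwt1 hR hS hR' hS' hδ hc hM hML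
    ?_ ?_ ?_ ?_ tFpt tGtsh tGtpt tFtsh ?_ hid
  · -- hFpt: the designated first leg is the VALUE `E(w)`: pointwise from `h0`
    intro m hm b hb w hw i _ hiF
    rw [Finset.mem_singleton] at hiF
    subst hiF
    have hn := hpow m hm
    have hw0 : w ≠ 0 := ne_zero_of_mem_annulus hw
    have hwM : (supNorm w : ℝ) ≤ ((Lc ^ m : ℕ) : ℝ) := by
      exact_mod_cast ((mem_annulus_iff.mp hw).2).trans (hML _ hn)
    show |stP μ ν (Gf (Lc ^ m) b) (Sum.inr true) w - (bfP hμν (Sum.inr true)).f (Lc ^ m) 0 w| ≤ _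
    rw [eP, stP_inr_true, a_bfP_inr_true_sub]
    refine windowBound_of_scaleBound (a := 2) (by have := hD 0; positivity) le_rfl hw0 hwM ?_
    have h := h0 _ hn b hb w
    simp only [Pi.sub_apply] at h ⊢
    refine h.trans ?_
    exact div_le_div_of_nonneg_right (by linarith [hD 0]) (by positivity)
  · -- hGsh: the designated second leg is the MIXED DIFFERENCE at `w`: shell row `h2s`
    intro m hm b hb r hr i _ hiF
    rw [Finset.mem_singleton] at hiF
    subst hiF
    have hn := hpow m hm
    have hn0 : (0 : ℝ) < ((Lc ^ m : ℕ) : ℝ) := by positivity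
    have ht0 : (0 : ℝ) < (r : ℝ) + 1 := by positivity
    show ∑ w ∈ annulus 4 r (r + 1), |stQ μ ν (Gf (Lc ^ m) b) (Sum.inr true) w - (bfQ hμν (Sum.inr true)).f (Lc ^ m) 0 w| ≤ _
    simp_rw [eQ, stQ_inr_true, a_bfQ_inr_true_sub, a_bfQ_inr_true]
    have h := h2s _ hn b hb r hr
    simp only [Pi.sub_apply] at h ⊢
    exact h.trans (window_shape_le ht0 hn0 (by linarith [hD 2]))
  · -- hGpt: off the ghost index the second leg is a value or a gradient: pointwise from `h0`/`h1`
    intro m hm b hb w hw i _ hiF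
    rw [hmem] at hiF
    have hn := hpow m hm
    have hw0 : w ≠ 0 := ne_zero_of_mem_annulus hw
    have hwM : (supNorm w : ℝ) ≤ ((Lc ^ m : ℕ) : ℝ) := by
      exact_mod_cast ((mem_annulus_iff.mp hw).2).trans (hML _ hn)
    show |stQ μ ν (Gf (Lc ^ m) b) i w - (bfQ hμν i).f (Lc ^ m) 0 w| ≤ _
    rw [eQ]
    have key := abs_stQ_low_le hμν i hiF (Gf (Lc ^ m) b - gFree) w (e := fun j => D j / ((Lc ^ m : ℕ) : ℝ) ^ (j + 2))
      (by simpa using h0 _ hn b hb (w + (unitVec μ + unitVec ν))) (by simpa using h0 _ hn b hb (w + unitVec ν))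
      (by have h := h1 _ hn b hb (w + unitVec μ) ν; simpa [add_assoc] using h) (by simpa using h1 _ hn b hb w ν)
    have ha : (bfQ hμν i).a - 2 + 2 = (bfQ hμν i).a := Nat.sub_add_cancel (two_le_bfQ_a hμν i)
    simp only [ha] at key
    refine (windowBound_of_scaleBound (hD _) (two_le_bfQ_a hμν i) hw0 hwM key).trans ?_
    apply div_le_div_of_nonneg_right _ (by positivity)
    linarith [hD ((bfQ hμν i).a - 2)]
  · -- hFsh: off the ghost index the first leg is the mixed difference (`h2s`) or the `μ`-gradient at `w` (pointwise `h1`, summed)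
    intro m hm b hb r hr i _ hiF
    rw [hmem] at hiF
    have hn := hpow m hm
    have hn0 : (0 : ℝ) < ((Lc ^ m : ℕ) : ℝ) := by positivity
    have ht0 : (0 : ℝ) < (r : ℝ) + 1 := by positivity
    have hrn : (r : ℝ) + 1 ≤ ((Lc ^ m : ℕ) : ℝ) := by exact_mod_cast hr.trans (hML _ hn)
    show ∑ w ∈ annulus 4 r (r + 1), |stP μ ν (Gf (Lc ^ m) b) i w - (bfP hμν i).f (Lc ^ m) 0 w| ≤ _
    simp_rw [eP]
    rcases stP_low hμν i hiF (Gf (Lc ^ m) b - gFree) with ⟨e, ha2, ha⟩ | ⟨e, ha1, ha⟩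
    · -- mixed difference, degree 4
      simp_rw [e, ha2, ha]
      have h := h2s _ hn b hb r hr
      simp only [Pi.sub_apply] at h ⊢
      exact h.trans (window_shape_le ht0 hn0 (by linarith [hD 2]))
    · -- gradient, degree 3
      simp_rw [e, ha1, ha]
      have hpt : ∀ w ∈ annulus 4 r (r + 1),
          |(Gf (Lc ^ m) b - gFree) (w + unitVec μ) - (Gf (Lc ^ m) b - gFree) w| ≤ D 1 / ((Lc ^ m : ℕ) : ℝ) ^ 3 :=
        fun w _ => by simpa using h1 _ hn b hb w μ
      exact (shell_sum_le_of_pointwise (by have := hD 1; positivity) hpt).trans (grad_shape_le ht0 hn0 hrn (hD 1))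
  · -- hident: from the full-sum comparison, by the shell tails of `stK`
    exact hident_of_fullSum_avg_shell (K := fun m b => stK μ ν N (Gf (Lc ^ m) b)) (by omega) hE hδ
      (fun m hm => hwt0 _ (hpow m hm)) (fun m hm => hwt1 _ (hpow m hm)) htail hU one_pos

end ScalarWall

end

end Summit.QuantumFields.BalabanUV.Beta.D1BFx.ShellGradedRoad
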